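import Literature.Analysis.OperatorTheory.BoundedPerturbationInverse
import Literature.Analysis.OperatorTheory.FiniteRankCapacitance
import HarnessLib

/-!
# From certified solves of a finite-rank–shifted operator to a resolvent bound (capacitance recipe)

Topic `Literature/Analysis/OperatorTheory`; proofs-layer file. Frame: `HasBoundedInverse p T B` (a bounded two-sided
inverse `B : E →L E` of a linear `T : p → E` on a submodule `p ≤ E`), `resolventShift p L z = L − z`.

**The recipe this file certifies.** Let `L : p → E` be linear, `z` a scalar, and `F = finiteRank f g`,
`F x = ∑ i, g i x • f i`, a finite-rank bounded operator (in validated numerics: a Gershgorin / spectral shift that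
makes `L + F − z` coercive). Suppose
* `G := (L + F|ₚ) − z` has a bounded inverse `B` with `‖B‖ ≤ M₀` (one certified bound, e.g. from coercivity:
  `exists_hasBoundedInverse_norm_le_of_coercive`);
* the `n × n` capacitance matrix `C j i = g j (B (f i))` — computable from the `n` solves `w i := B (f i)` — has
  `1 − C` invertible with a two-sided inverse `N` (certified by interval linear algebra).
Then `L − z` itself has a bounded inverse, of norm at most `M₀ · (1 + ∑ i, (∑ j, ‖N i j‖ ‖g j ∘ B‖) ‖f i‖)`
(`exists_hasBoundedInverse_of_capacitance`), and — the tight form — `(L − z)⁻¹ = B + K` with the explicit finite-rank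
`K = ∑ i, (N *ᵥ (g · ∘ B)) i • B (f i)`, so that `‖(L − z)⁻¹‖ ≤ M₀ + M₁` for any certified `‖K‖ ≤ M₁`
(`exists_hasBoundedInverse_of_capacitance_add`). This is the Sherman–Morrison–Woodbury identity
`(G − F)⁻¹ = B (1 − F B)⁻¹` combined with the degenerate-operator determinant criterion
[cite: Kato1966, III-§4.3, (4.13) with IV-§1.4, Thm. 1.16]; W. W. Hager, SIAM Review 31 (1989) 221–239.

Nothing here refers to a particular operator; the file is the last link of the kernel chain
residual → circle/net of inverse bounds → enclosure (`PseudospectralEnclosure{,Unbounded,Net}.lean`).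
-/

namespace Literature.Analysis.OperatorTheory

open scoped BigOperators

variable {𝕜 : Type*} [NontriviallyNormedField 𝕜]
variable {E : Type*} [NormedAddCommGroup E] [NormedSpace 𝕜 E]
variable {ι : Type*} [Fintype ι] [DecidableEq ι]

omit [DecidableEq ι] in
/-- Right composition of a finite-rank operator with a bounded operator is finite rank with the composed functionals:
`(∑ i, g i • f i) ∘ B = ∑ i, (g i ∘ B) • f i`. [folklore] -/
theorem finiteRank_comp (f : ι → E) (g : ι → E →L[𝕜] 𝕜) (B : E →L[𝕜] E) :
    (finiteRank f g).comp B = finiteRank f (fun i => (g i).comp B) := by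
  ext x
  simp [finiteRank_apply]

/-- **Capacitance recipe.** If `(L + F|ₚ) − z` (with `F = finiteRank f g`) has a bounded inverse `B`, `‖B‖ ≤ M₀`, and the
capacitance matrix `C j i = g j (B (f i))` has `1 − C` two-sidedly inverted by `N`, then `L − z` has a bounded inverse of
norm `≤ M₀ · (1 + ∑ i, (∑ j, ‖N i j‖ ‖g j ∘ B‖) ‖f i‖)`. [cite: Kato1966, III-§4.3, (4.13) with IV-§1.4, Thm. 1.16] -/
theorem exists_hasBoundedInverse_of_capacitance {p : Submodule 𝕜 E} {L : p →ₗ[𝕜] E} {z : 𝕜}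
    (f : ι → E) (g : ι → E →L[𝕜] 𝕜) {B : E →L[𝕜] E} {M₀ : ℝ}
    (hG : HasBoundedInverse p
      (resolventShift p (L + ((finiteRank f g : E →L[𝕜] E) : E →ₗ[𝕜] E).comp p.subtype) z) B)
    (hB : ‖B‖ ≤ M₀) (N : Matrix ι ι 𝕜)
    (hN₁ : (1 - capMatrix f (fun i => (g i).comp B)) * N = 1)
    (hN₂ : N * (1 - capMatrix f (fun i => (g i).comp B)) = 1) :
    ∃ B' : E →L[𝕜] E, HasBoundedInverse p (resolventShift p L z) B' ∧
      ‖B'‖ ≤ M₀ * (1 + ∑ i, (∑ j, ‖N i j‖ * ‖(g j).comp B‖) * ‖f i‖) := by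
  obtain ⟨W, hWval, hWnorm⟩ := exists_unit_one_sub_finiteRank f (fun i => (g i).comp B) N hN₁ hN₂
  have hW : (W : E →L[𝕜] E) = 1 - (finiteRank f g).comp B := by rw [hWval, finiteRank_comp]
  have h := hG.sub_of_unit (finiteRank f g) W hW
  have hT : resolventShift p (L + ((finiteRank f g : E →L[𝕜] E) : E →ₗ[𝕜] E).comp p.subtype) z
      - ((finiteRank f g : E →L[𝕜] E) : E →ₗ[𝕜] E).comp p.subtype = resolventShift p L z := by
    rw [resolventShift_sub, add_sub_cancel_right]
  rw [hT] at h
  refine ⟨_, h, ?_⟩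
  have hM₀ : 0 ≤ M₀ := (norm_nonneg _).trans hB
  calc ‖B.comp (↑W⁻¹ : E →L[𝕜] E)‖ ≤ ‖B‖ * ‖(↑W⁻¹ : E →L[𝕜] E)‖ := ContinuousLinearMap.opNorm_comp_le _ _
    _ ≤ M₀ * (1 + ∑ i, (∑ j, ‖N i j‖ * ‖(g j).comp B‖) * ‖f i‖) :=
        mul_le_mul hB hWnorm (norm_nonneg _) hM₀

omit [DecidableEq ι] in
/-- The explicit inverse in ADDITIVE (Woodbury) form: `B ∘ capInverse = B + K` with the finite-rank correction
`K y = ∑ i, (N *ᵥ (g · (B y))) i • B (f i)`, i.e. `K = finiteRank (B ∘ f) (fun i => ∑ j, N i j • (g j ∘ B))`. [folklore] -/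
theorem comp_capInverse_eq_add_finiteRank (f : ι → E) (g : ι → E →L[𝕜] 𝕜) (B : E →L[𝕜] E) (N : Matrix ι ι 𝕜) :
    B.comp (capInverse f (fun i => (g i).comp B) N) =
      B + finiteRank (fun i => B (f i)) (fun i => ∑ j, N i j • (g j).comp B) := by
  ext y
  simp [capInverse_apply, finiteRank_apply, map_sum, map_smul, Matrix.mulVec, dotProduct, smul_eq_mul]

/-- **Capacitance recipe, additive bound (the tight form).** Under the hypotheses of
`exists_hasBoundedInverse_of_capacitance`, `L − z` has the bounded inverse `B + K` with the explicit finite-rank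
`K = finiteRank (B ∘ f) (fun i => ∑ j, N i j • (g j ∘ B))`; hence any certified bound `‖K‖ ≤ M₁` (in Hilbert space:
`‖K‖ = ‖G_w^{1/2} N G_w̃^{1/2}‖₂` from the Gram matrices of the solves `w i = B (f i)` and adjoint solves) gives
`‖(L − z)⁻¹‖ ≤ M₀ + M₁` — with no multiplicative loss. [cite: Kato1966, III-§4.3, (4.13) with IV-§1.4, Thm. 1.16] -/
theorem exists_hasBoundedInverse_of_capacitance_add {p : Submodule 𝕜 E} {L : p →ₗ[𝕜] E} {z : 𝕜}
    (f : ι → E) (g : ι → E →L[𝕜] 𝕜) {B : E →L[𝕜] E} {M₀ M₁ : ℝ}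
    (hG : HasBoundedInverse p
      (resolventShift p (L + ((finiteRank f g : E →L[𝕜] E) : E →ₗ[𝕜] E).comp p.subtype) z) B)
    (hB : ‖B‖ ≤ M₀) (N : Matrix ι ι 𝕜)
    (hN₁ : (1 - capMatrix f (fun i => (g i).comp B)) * N = 1)
    (hN₂ : N * (1 - capMatrix f (fun i => (g i).comp B)) = 1)
    (hK : ‖finiteRank (fun i => B (f i)) (fun i => ∑ j, N i j • (g j).comp B)‖ ≤ M₁) :
    ∃ B' : E →L[𝕜] E, HasBoundedInverse p (resolventShift p L z) B' ∧ ‖B'‖ ≤ M₀ + M₁ := by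
  have hW : ((capUnit f (fun i => (g i).comp B) N hN₁ hN₂ : (E →L[𝕜] E)ˣ) : E →L[𝕜] E)
      = 1 - (finiteRank f g).comp B := by rw [capUnit_val, finiteRank_comp]
  have h := hG.sub_of_unit (finiteRank f g) _ hW
  have hT : resolventShift p (L + ((finiteRank f g : E →L[𝕜] E) : E →ₗ[𝕜] E).comp p.subtype) z
      - ((finiteRank f g : E →L[𝕜] E) : E →ₗ[𝕜] E).comp p.subtype = resolventShift p L z := by
    rw [resolventShift_sub, add_sub_cancel_right]
  rw [hT, capUnit_inv, comp_capInverse_eq_add_finiteRank] at h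
  exact ⟨_, h, (norm_add_le _ _).trans (add_le_add hB hK)⟩

omit [Fintype ι] [DecidableEq ι] in
/-- The entries of the capacitance matrix are the functionals evaluated at the solves `w i = B (f i)`:
`capMatrix f (g ∘ B) j i = g j (B (f i))`. [folklore] -/
theorem capMatrix_comp_apply (f : ι → E) (g : ι → E →L[𝕜] 𝕜) (B : E →L[𝕜] E) (j i : ι) :
    capMatrix f (fun i => (g i).comp B) j i = g j (B (f i)) := rfl

end Literature.Analysis.OperatorTheory
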